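import Literature.AnabelianGeometry.EtaleTheta.TemperedFrobenioidCoprimePullDiagonal
import Literature.AnabelianGeometry.EtaleTheta.TemperedFrobenioidDiagonalOfKummerTateTower
import Literature.AnabelianGeometry.EtaleTheta.TemperedFrobenioidOfDiagonalBaseR
import HarnessLib

/-!
# [EtTh] Def. 4.1 (i) / GAP G-w5d063-1: the coprimality-pull-back law `CoprimePullLaw` HOLDS at the ℤ-tower tempered
# Frobenioids (every character, `Λ = ℤ` and `ℝ`) and at the diagonal-base tempered Frobenioid of the Kummer–Tate tower —
# «pointwise minima of equivariant divisors» (proof-only)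

S. Mochizuki, *The étale theta function …*, Publ. RIMS **45** (2009) [MochizukiEtTh2009], §3 Def. 3.3 (iii) / Rmk. 3.3.1 p.73,
Def. 3.6 (ii) p.77, §4 Def. 4.1 (i) p.86 («`Div(s′)`, `Div(s″)` have disjoint supports»), proof of Prop. 4.2 (iii) pp.89–90
[cite: MochizukiEtTh2009, Def 4.1 (i) p.86]; [FrdI] §0 p.11 (`M^pf`), Def. 2.4 (i) p.47.

abc-iut cell, layer L2 [EtTh], seat abc-iut-w5-d179 (gen 6); PROOF-ONLY (0 defs).  abc-iut-L2-t3's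
`coprimePullLaw_ofDiagonalBase_of_perfection` (p468312, `TemperedFrobenioidCoprimePullDiagonal.lean`) reduces the predicate of
record `TemperedFrobenioid.CoprimePullLaw` (= the binder `hDSpull` of GAP G-w5d063-1; ✗ in general, `ShearToy.not_coprimePull`)
at this seat's higher-rank engine `ofDiagonalBase` to ONE geometric input on the perfections `Φ₀(F A)^pf`: pull-backs carry
pairs without common non-trivial divisor to such pairs.  THIS FILE supplies that input for the ℤ-tower datum and fires it:
* §1 divisibility in `Φ₀(S)^pf` through the ℕ-coordinates (`ZTower.dvd_of_of_dvd_of`, `pow_dvd_pow_of_mk_dvd_mk`,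
  `mk_dvd_mk_of_dvd`), the POINTWISE MINIMUM of two equivariant effective log-divisors (`exists_coord_min`: again equivariant
  — the action translates the coordinates), `isSharp_phiZero`;
* §2 **`ZTower.perfection_coprime_pull_pow`**: along ANY `Γ`-map `f : S → S'`, if `η ∈ Φ₀(S)^pf` divides positive powers of the
  pull-backs of a pair `α, β ∈ Φ₀(S')^pf` without common non-trivial divisor, then `η = 1` — a non-trivial `η` has a positive
  coordinate at some `(s, F_j)`, forcing `α` and `β` both positive at `(f s, F_j)`, where the class of `min(a^l, b^k)^{1/(kl)}` is
  then a common non-trivial divisor;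
* §3 REGISTER ✓: **`ZTowerTempered.coprimePullLaw X φ R S`** (`Λ = ℤ`, every `X`, every character `φ`),
  **`ZTowerTempered.coprimePullLaw_R`** (`Λ = ℝ`, same `Φ`), **`TateTowerKummer.coprimePullLaw_diag`** (the diagonal-base tf of the
  Kummer–Tate tower over the whole of `B^temp(Grp)⁰`, where the transition also raises to the ramification index `e`).
HONEST FRAMING: implications between OUR typed predicates at combinatorial consistency data; nothing asserted about tempered
Frobenioids of curves; nothing here bears on the disputed [IUTchIII] Cor. 3.12; no side taken; typed ≠ proved — here proved.
-/

namespace Literature.AnabelianGeometry.EtaleTheta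

open CategoryTheory Opposite Function Literature.AlgebraicGeometry.Frobenioids
  Literature.AnabelianGeometry.SemiGraphs LogDivisorModel LogDivisorModel.GaloisAction LogDivisorTower

/-! ## §1 Divisibility in `Φ₀(S)^pf` through the coordinates; pointwise minima -/

namespace LogDivisorModel.ZTower

open TateTower

variable {Γ : Type} [Group Γ] (φ : Γ →* Multiplicative ℤ) (S : Action (Type 0) Γ)

/-- Classes with a common index: `x ∣ y ⇒ x^{1/N} ∣ y^{1/N}`. [cite: MochizukiFrdI2008, §0 p.11] -/
private theorem mk_dvd_mk_of_dvd {M : Type} [CommMonoid M] {x y : M} (h : x ∣ y) (N : ℕ+) :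
    Perfection.mk x N ∣ Perfection.mk y N := by
  obtain ⟨c, rfl⟩ := h
  exact ⟨Perfection.mk c N, by rw [Perfection.mk_mul_mk, ← mul_pow, Perfection.mk_pow_mul]⟩

/-- `Φ₀(S)` is sharp (coordinates are non-negative). [cite: MochizukiEtTh2009, Def 3.3 p.73] -/
theorem isSharp_phiZero : IsSharp ((action φ).phiZero S) :=
  ⟨fun ψ hψ => by
    obtain ⟨u, rfl⟩ := hψ
    refine coord_separating φ S fun s n => ?_
    have h : coord φ S s n (u : (action φ).phiZero S) * coord φ S s n (↑u⁻¹ : (action φ).phiZero S) = 1 := by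
      rw [← map_mul, Units.mul_inv, map_one]
    rw [(mul_eq_one.mp h).1, map_one]⟩

/-- `Φ₀(S) → Φ₀(S)^pf` reflects divisibility. [cite: MochizukiFrdI2008, §0 p.11] -/
theorem dvd_of_of_dvd_of {x y : (action φ).phiZero S} (h : Perfection.of _ x ∣ Perfection.of _ y) : x ∣ y := by
  obtain ⟨ζ, hζ⟩ := h
  obtain ⟨⟨c, l⟩, rfl⟩ := Perfection.mk_surjective ζ
  dsimp only at hζ
  rw [Perfection.of_apply, Perfection.of_apply, Perfection.mk_mul_mk, Perfection.mk_eq_mk_iff] at hζ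
  obtain ⟨N, hN⟩ := hζ
  rw [PNat.mul_coe, PNat.one_coe, one_mul, mul_one, pow_one, mul_pow, ← pow_mul, mul_comm (l : ℕ)] at hN
  exact (pow_dvd_pow_iff φ S (Nat.mul_pos N.pos l.pos)).1 ⟨c ^ (N : ℕ), hN⟩

/-- **`m^{1/n} ∣ a^{1/k}` in `Φ₀(S)^pf` forces `m^k ∣ a^n` in `Φ₀(S)`.** [cite: MochizukiFrdI2008, §0 p.11] -/
theorem pow_dvd_pow_of_mk_dvd_mk {m a : (action φ).phiZero S} {n k : ℕ+} (h : Perfection.mk m n ∣ Perfection.mk a k) :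
    m ^ (k : ℕ) ∣ a ^ (n : ℕ) := by
  have h1 : Perfection.mk m n ^ ((n : ℕ) * k) ∣ Perfection.mk a k ^ ((n : ℕ) * k) := pow_dvd_pow_of_dvd h _
  have e1 : Perfection.mk m n ^ ((n : ℕ) * k) = Perfection.of _ (m ^ (k : ℕ)) := by
    rw [pow_mul, Perfection.mk_pow_self, map_pow]
  have e2 : Perfection.mk a k ^ ((n : ℕ) * k) = Perfection.of _ (a ^ (n : ℕ)) := by
    rw [mul_comm, pow_mul, Perfection.mk_pow_self, map_pow]
  rw [e1, e2] at h1
  exact dvd_of_of_dvd_of φ S h1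

/-- The coordinate inequality of a divisibility `m^{1/n} ∣ a^{1/k}` in `Φ₀(S)^pf`: `k·coord(m) ≤ n·coord(a)`.
[cite: MochizukiFrdI2008, §0 p.11] -/
theorem coord_le_of_mk_dvd_mk {m a : (action φ).phiZero S} {n k : ℕ+} (h : Perfection.mk m n ∣ Perfection.mk a k)
    (s : S.V) (j : ℤ) :
    (k : ℕ) * Multiplicative.toAdd (coord φ S s j m) ≤ (n : ℕ) * Multiplicative.toAdd (coord φ S s j a) := by
  have h1 := toAdd_coord_le_of_dvd φ S (pow_dvd_pow_of_mk_dvd_mk φ S h) s j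
  rwa [coord_pow, coord_pow, toAdd_ofAdd, toAdd_ofAdd] at h1

/-- **The pointwise minimum of two elements of `Φ₀(S)` lies in `Φ₀(S)`** (effective, and equivariant because the action
translates the coordinates). [cite: MochizukiEtTh2009, Def 3.3 p.73] -/
theorem exists_coord_min (ψ ψ' : (action φ).phiZero S) :
    ∃ χ : (action φ).phiZero S, ∀ (s : S.V) (n : ℤ),
      Multiplicative.toAdd (coord φ S s n χ) =
        min (Multiplicative.toAdd (coord φ S s n ψ)) (Multiplicative.toAdd (coord φ S s n ψ')) := by
  refine ⟨⟨fun s => Multiplicative.ofAdd (α := TateTower.Idx → ℤ) fun x => min (mlt (ψ.1 s) x) (mlt (ψ'.1 s) x),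
    fun s => mem_Divplus_of_nonneg fun x => le_min (mlt_nonneg φ S ψ s x) (mlt_nonneg φ S ψ' s x), fun g s => ?_⟩, fun s n => ?_⟩
  · refine ext_mlt fun x => ?_
    rcases x with c | n
    · exact c.elim
    · rw [mlt_actDIV_inr]
      show min (mlt (ψ.1 (S.ρ g s)) (Sum.inr n)) (mlt (ψ'.1 (S.ρ g s)) (Sum.inr n)) =
        min (mlt (ψ.1 s) (Sum.inr (n - Multiplicative.toAdd (φ g)))) (mlt (ψ'.1 s) (Sum.inr (n - Multiplicative.toAdd (φ g))))
      rw [mlt_ρ, mlt_ρ]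
  · apply Nat.cast_injective (R := ℤ)
    rw [coord_natCast, Nat.cast_min, coord_natCast, coord_natCast]
    rfl

/-! ## §2 The geometric input: coprime pairs pull back to coprime pairs on the perfections -/

variable {S}

/-- **Coprime pull-back at the ℤ-tower, with exponents.**  Along any `Γ`-map `f : S → S'`: if `η ∈ Φ₀(S)^pf` divides some
power of the pull-backs of `α, β ∈ Φ₀(S')^pf`, and `α, β` have no common non-trivial divisor, then `η = 1`.
[cite: MochizukiEtTh2009, Def 4.1 (i) p.86] -/
theorem perfection_coprime_pull_pow {S' : Action (Type 0) Γ} (f : S ⟶ S') (α β : Perfection ((action φ).phiZero S'))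
    (hab : ∀ ξ : Perfection ((action φ).phiZero S'), ξ ∣ α → ξ ∣ β → ξ = 1) (e : ℕ)
    (η : Perfection ((action φ).phiZero S))
    (hηa : η ∣ Literature.AlgebraicGeometry.Frobenioids.Perfection.map ((action φ).phiZeroPull f) α ^ e) (hηb : η ∣ Literature.AlgebraicGeometry.Frobenioids.Perfection.map ((action φ).phiZeroPull f) β ^ e) :
    η = 1 := by
  obtain ⟨⟨m, n⟩, rfl⟩ := Perfection.mk_surjective η
  obtain ⟨⟨a, k⟩, rfl⟩ := Perfection.mk_surjective α
  obtain ⟨⟨b, l⟩, rfl⟩ := Perfection.mk_surjective β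
  dsimp only at hab hηa hηb ⊢
  rw [Perfection.map_mk, Perfection.mk_pow] at hηa hηb
  -- the pointwise minimum of `a^l` and `b^k`
  obtain ⟨χ, hχ⟩ := exists_coord_min φ S' (a ^ (l : ℕ)) (b ^ (k : ℕ))
  have hξa : Perfection.mk χ (k * l) ∣ Perfection.mk a k := by
    rw [← Perfection.mk_pow_mul a k l]
    exact mk_dvd_mk_of_dvd (dvd_of_toAdd_coord_le φ S' fun s j => by rw [hχ]; exact min_le_left _ _) _
  have hξb : Perfection.mk χ (k * l) ∣ Perfection.mk b l := by
    rw [← Perfection.mk_pow_mul b l k, mul_comm l k]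
    exact mk_dvd_mk_of_dvd (dvd_of_toAdd_coord_le φ S' fun s j => by rw [hχ]; exact min_le_right _ _) _
  have hχ1 : χ = 1 := (Perfection.mk_eq_one_iff_of_isSharp (isSharp_phiZero φ S')).1 (hab _ hξa hξb)
  -- hence `m` has no positive coordinate
  suffices hm : m = 1 by rw [hm, Perfection.mk_one]
  refine coord_separating φ S fun s j => ?_
  rw [map_one]
  by_contra hne
  have hm0 : Multiplicative.toAdd (coord φ S s j m) ≠ 0 := fun h0 =>
    hne (by rw [← ofAdd_toAdd (coord φ S s j m), h0, ofAdd_zero])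
  have ha := coord_le_of_mk_dvd_mk φ S hηa s j
  have hb := coord_le_of_mk_dvd_mk φ S hηb s j
  rw [map_pow, coord_phiZeroPull, toAdd_pow, smul_eq_mul] at ha hb
  have ha0 : Multiplicative.toAdd (coord φ S' (f.hom s) j a) ≠ 0 := fun h0 => by
    rw [h0, mul_zero, mul_zero, Nat.le_zero, Nat.mul_eq_zero] at ha
    exact ha.elim (fun hk => k.ne_zero hk) hm0
  have hb0 : Multiplicative.toAdd (coord φ S' (f.hom s) j b) ≠ 0 := fun h0 => by
    rw [h0, mul_zero, mul_zero, Nat.le_zero, Nat.mul_eq_zero] at hb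
    exact hb.elim (fun hl => l.ne_zero hl) hm0
  have hχ0 := hχ (f.hom s) j
  rw [hχ1, map_one, toAdd_one, coord_pow, coord_pow, toAdd_ofAdd, toAdd_ofAdd] at hχ0
  have hpos : 0 < min ((l : ℕ) * Multiplicative.toAdd (coord φ S' (f.hom s) j a))
      ((k : ℕ) * Multiplicative.toAdd (coord φ S' (f.hom s) j b)) :=
    lt_min (Nat.mul_pos l.pos (Nat.pos_of_ne_zero ha0)) (Nat.mul_pos k.pos (Nat.pos_of_ne_zero hb0))
  rw [← hχ0] at hpos
  exact lt_irrefl _ hpos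

/-- **Coprime pull-back at the ℤ-tower** (exponent `1`): the geometric input of abc-iut-L2-t3's
`coprimePullLaw_ofDiagonalBase_of_perfection`. [cite: MochizukiEtTh2009, Def 4.1 (i) p.86] -/
theorem perfection_coprime_pull {S' : Action (Type 0) Γ} (f : S ⟶ S') (α β : Perfection ((action φ).phiZero S'))
    (hab : ∀ ξ : Perfection ((action φ).phiZero S'), ξ ∣ α → ξ ∣ β → ξ = 1) (η : Perfection ((action φ).phiZero S))
    (hηa : η ∣ Literature.AlgebraicGeometry.Frobenioids.Perfection.map ((action φ).phiZeroPull f) α) (hηb : η ∣ Literature.AlgebraicGeometry.Frobenioids.Perfection.map ((action φ).phiZeroPull f) β) : η = 1 :=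
  perfection_coprime_pull_pow φ f α β hab 1 η (by rwa [pow_one]) (by rwa [pow_one])

end LogDivisorModel.ZTower

/-! ## §3 REGISTER: the law at the ℤ-tower tempered Frobenioids and at the Kummer–Tate diagonal base -/

namespace ZTowerTempered

variable {K : Type} [Field K] (X : SemiGraphs.TemperedArithmeticGroup.{0} K) (φ : X.Pi →* Multiplicative ℤ)
  (R S : ((ConnectedPart (BTemp X.Pi))ᵒᵖ ⥤ CommMonCat.{0}) → Prop)

/-- **`CoprimePullLaw` HOLDS at the ℤ-tower tempered Frobenioid** (`Λ = ℤ`; every `X`, every character `φ`) — the binder `hDSpull` of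
GAP G-w5d063-1 is DISCHARGED at this higher-rank constructed model. [cite: MochizukiEtTh2009, Def 4.1 (i) p.86] -/
theorem coprimePullLaw : (temperedFrobenioid X φ R S).CoprimePullLaw :=
  TemperedFrobenioid.coprimePullLaw_ofDiagonalBase_of_perfection (hpf X φ) (diagonalBase X φ) _ _ _ R S
    fun _ α β hab η hηa hηb => ZTower.perfection_coprime_pull φ _ α β hab η hηa hηb

/-- **`CoprimePullLaw` HOLDS at the `Λ = ℝ` ℤ-tower tempered Frobenioid** (same divisor monoid `Φ`).
[cite: MochizukiEtTh2009, Def 4.1 (i) p.86] -/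
theorem coprimePullLaw_R : (temperedFrobenioidR X φ R S).CoprimePullLaw := coprimePullLaw X φ R S

end ZTowerTempered

namespace TateTowerKummer

variable (R S : ((ConnectedPart (BTemp Grp))ᵒᵖ ⥤ CommMonCat.{0}) → Prop)

/-- The v2 transition of `Φ₀` on perfections: `Φ₀(f)^pf(α) = (pull-back of α)^e`. [cite: MochizukiEtTh2009, Def 3.3 (iii) p.74] -/
theorem perfection_map_Φ₀_map {Y Y' : (ConnectedPart (BTemp Grp))ᵒᵖ} (f : Y ⟶ Y')
    (α : Perfection ((DivisorMonoids.ofTower tower).Φ₀.obj Y)) :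
    Literature.AlgebraicGeometry.Frobenioids.Perfection.map ((DivisorMonoids.ofTower tower).Φ₀.map f).hom α =
      Literature.AlgebraicGeometry.Frobenioids.Perfection.map ((ZTower.action γ).phiZeroPull f.unop.hom.hom) α ^ e (levels.lvl Y.unop) (levels.lvl Y'.unop) := by
  obtain ⟨⟨a, n⟩, rfl⟩ := Perfection.mk_surjective α
  show Perfection.mk (((DivisorMonoids.ofTower tower).Φ₀.map f).hom a) n =
    Perfection.mk ((ZTower.action γ).phiZeroPull f.unop.hom.hom a) n ^ e (levels.lvl Y.unop) (levels.lvl Y'.unop)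
  rw [Perfection.mk_pow]
  exact congrArg (fun x => Perfection.mk x n) (Φ₀_map_hom_eq f a)

/-- **`CoprimePullLaw` HOLDS at the diagonal-base tempered Frobenioid of the Kummer–Tate tower** (over the whole of `B^temp(Grp)⁰`;
the transition raises to the positive ramification index, which the coprime-pull argument absorbs).
[cite: MochizukiEtTh2009, Def 4.1 (i) p.86] -/
theorem coprimePullLaw_diag : (diagTemperedFrobenioid R S).CoprimePullLaw :=
  TemperedFrobenioid.coprimePullLaw_ofDiagonalBase_of_perfection hpf diagonalBase _ _ _ R S
    fun f α β hab η hηa hηb => by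
      have hηa' : η ∣ Literature.AlgebraicGeometry.Frobenioids.Perfection.map ((DivisorMonoids.ofTower tower).Φ₀.map f.op).hom α :=
        hηa
      have hηb' : η ∣ Literature.AlgebraicGeometry.Frobenioids.Perfection.map ((DivisorMonoids.ofTower tower).Φ₀.map f.op).hom β :=
        hηb
      rw [perfection_map_Φ₀_map] at hηa' hηb'
      exact ZTower.perfection_coprime_pull_pow γ _ α β hab _ η hηa' hηb'

end TateTowerKummer

end Literature.AnabelianGeometry.EtaleTheta
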